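import Summits.ResolutionOfSingularities.ResolutionOfSingularities.Theorems.FrobeniusLadderFRationalResolutionWeaklyFRegularModelLocal
import Summits.ResolutionOfSingularities.ResolutionOfSingularities.Theorems.FrobeniusLadderFRationalResolutionSpreadOutFinite
import Summits.ResolutionOfSingularities.ResolutionOfSingularities.Theorems.FrobeniusLadderFRationalResolutionSurfaceSingularLocus
import Literature.AlgebraicGeometry.Resolution.CanonicalResolutionProofs
import HarnessLib

/-!
# Rung 3½ (piece `X₁`) in dimension 2 is PUNCTUAL: weakly F-regular modifications of F-rational
# surfaces come from local weakly F-regular models at the finitely many singular points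

Support file for crux stmt-ResolutionOfSingularities-15317 (`FrobeniusLadder.FRationalResolution`),
line `Sketch`, continuation seat c3, wave 10, theme (L). Rung 3½ of the ladder (the strategist's piece
`X₁`, `WeaklyFRegularModification`) asks that every F-rational `X` have a proper birational model all
of whose stalks are weakly F-regular (domains in which every ideal is tightly closed, in the crux's
inline form). In dimension `2` this is a ONE-GERM-AT-A-TIME problem, exactly as resolution is
(`hasResolution_fRational_surface_of_local`): an integral F-rational surface `X/k` (finite type,
`dim X ≤ 2`) has finitely many singular points (`finite_compl_regularLocus_of_fRational_surface`), its
regular locus `U` is open (fields are J-2, `isOpen_regularLocus_of_locallyOfFiniteType_field`) and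
dense (it contains the generic point), and at a point of `U` the stalk is a regular local ring of
characteristic `p`, hence a domain with every ideal tightly closed
(`weaklyFRegularClause_stalk_of_mem_regularLocus`). So the punctual gluing engine
`weaklyFRegularModel_of_local_models` applies: **if every singular point `s` has an open
neighbourhood `V` (meeting no other singular point) with a proper `ρ : Y → V`, all stalks of `Y`
domains with every ideal tightly closed, an isomorphism over `V ∩ Reg X` with dense preimage, then
`X` has a proper birational model `X' → X` all of whose stalks are domains with every ideal tightly
closed.** [folklore; Lipman 1978 §2 for the one-point-at-a-time strategy]
-/

-- single-problem summit: the doubled namespace component is forced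
set_option linter.dupNamespace false

noncomputable section

namespace Summit.ResolutionOfSingularities.ResolutionOfSingularities.Theorems.FRationalResolution

open CategoryTheory AlgebraicGeometry TopologicalSpace
open Literature.AlgebraicGeometry.Resolution

/-- **RUNG 3½ IN DIMENSION 2 IS PUNCTUAL.** For an integral `k`-scheme `X` of finite type over a
field `k` of characteristic `p`, of dimension `≤ 2`, whose stalks satisfy the F-rational clause of
`FRationalResolution`: if every singular point `s ∉ Reg X` has an open neighbourhood `V ∋ s`
containing no other singular point and a proper `ρ : Y → V`, all stalks of `Y` domains in which
every ideal is tightly closed (inline clause), which is an isomorphism over `V ∩ Reg X` with dense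
preimage, then `X` receives a proper birational `π : X' → X` all of whose stalks are domains in
which every ideal is tightly closed. (`Reg X` is open, dense, its complement is finite, and the
stalks at its points are regular, hence weakly F-regular; glue the local models one point at a
time, `weaklyFRegularModel_of_local_models`.) [folklore] -/
theorem weaklyFRegularModification_surface_of_local (p : ℕ) (hp : p.Prime) (k : Type) [Field k]
    [CharP k p] (X : Scheme.{0}) [IsIntegral X] (f : X ⟶ Spec (.of k)) [LocallyOfFiniteType f]
    [QuasiCompact f]
    (hFR : ∀ x : X, IsDomain (X.presheaf.stalk x) ∧ ∀ d : ℕ, ringKrullDim (X.presheaf.stalk x) = d →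
      ∀ s : Fin d → X.presheaf.stalk x, (Ideal.span (Set.range s)).radical.IsMaximal →
      ∀ y c : X.presheaf.stalk x, c ≠ 0 →
      (∀ e : ℕ, c * y ^ p ^ e ∈ Ideal.span ((fun z : X.presheaf.stalk x => z ^ p ^ e) ''
        (Ideal.span (Set.range s) : Set (X.presheaf.stalk x)))) → y ∈ Ideal.span (Set.range s))
    (hdim : topologicalKrullDim X ≤ 2)
    (hloc : ∀ s : X, s ∉ Scheme.regularLocus X → ∃ (V : X.Opens), s ∈ V ∧
      (∀ t : X, t ∉ Scheme.regularLocus X → t ∈ V → t = s) ∧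
      ∃ (Y : Scheme.{0}) (ρ : Y ⟶ V), IsProper ρ ∧
        (∀ y : Y, IsDomain (Y.presheaf.stalk y) ∧ ∀ I : Ideal (Y.presheaf.stalk y),
          ∀ a c : Y.presheaf.stalk y, c ≠ 0 →
          (∀ e : ℕ, c * a ^ p ^ e ∈ Ideal.span ((fun z : Y.presheaf.stalk y => z ^ p ^ e) ''
            (I : Set (Y.presheaf.stalk y)))) → a ∈ I) ∧
        IsIso (ρ ∣_ (V.ι ⁻¹ᵁ ⟨Scheme.regularLocus X, isOpen_regularLocus_of_locallyOfFiniteType_field f⟩)) ∧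
        Dense ((ρ ⁻¹ᵁ (V.ι ⁻¹ᵁ ⟨Scheme.regularLocus X,
          isOpen_regularLocus_of_locallyOfFiniteType_field f⟩) : Y.Opens) : Set Y)) :
    ∃ (X' : Scheme.{0}) (π : X' ⟶ X), IsProper π ∧ IsBirational π ∧
      ∀ x : X', IsDomain (X'.presheaf.stalk x) ∧ ∀ I : Ideal (X'.presheaf.stalk x),
        ∀ y c : X'.presheaf.stalk x, c ≠ 0 →
        (∀ e : ℕ, c * y ^ p ^ e ∈ Ideal.span ((fun z : X'.presheaf.stalk x => z ^ p ^ e) ''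
          (I : Set (X'.presheaf.stalk x)))) → y ∈ I := by
  classical
  haveI : IsNoetherian X := Scheme.isNoetherian_of_finiteType_over_field f
  -- the open regular locus `U`
  set U : X.Opens := ⟨Scheme.regularLocus X, isOpen_regularLocus_of_locallyOfFiniteType_field f⟩
    with hU
  have hmemU : ∀ x : X, x ∈ U ↔ x ∈ Scheme.regularLocus X := fun x => Iff.rfl
  -- at the points of `U` the stalks are domains with every ideal tightly closed
  have hUwf : ∀ x : X, x ∈ U → IsDomain (X.presheaf.stalk x) ∧ ∀ I : Ideal (X.presheaf.stalk x),
      ∀ y c : X.presheaf.stalk x, c ≠ 0 →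
      (∀ e : ℕ, c * y ^ p ^ e ∈ Ideal.span ((fun z : X.presheaf.stalk x => z ^ p ^ e) ''
        (I : Set (X.presheaf.stalk x)))) → y ∈ I := fun x hx =>
    ⟨(hFR x).1, fun I y c hc hy =>
      weaklyFRegularClause_stalk_of_mem_regularLocus p hp k X f ((hmemU x).mp hx) I y c hc hy⟩
  -- the finitely many singular points
  have hfin : (Scheme.regularLocus X)ᶜ.Finite :=
    finite_compl_regularLocus_of_fRational_surface p hp k X f hFR hdim
  set S : Finset X := hfin.toFinset with hS
  have hmemS : ∀ x : X, x ∈ S ↔ x ∉ Scheme.regularLocus X := fun x => by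
    rw [hS, Set.Finite.mem_toFinset]; rfl
  have hcov : ∀ x : X, x ∈ U ∨ x ∈ S := fun x => by
    by_cases hx : x ∈ Scheme.regularLocus X
    · exact Or.inl hx
    · exact Or.inr ((hmemS x).mpr hx)
  -- local weakly F-regular models, repackaged over `S`
  have hloc' : ∀ s ∈ S, ∃ (V : X.Opens), s ∈ V ∧ (∀ t ∈ S, t ∈ V → t = s) ∧
      ∃ (Y : Scheme.{0}) (ρ : Y ⟶ V), IsProper ρ ∧
        (∀ y : Y, IsDomain (Y.presheaf.stalk y) ∧ ∀ I : Ideal (Y.presheaf.stalk y),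
          ∀ a c : Y.presheaf.stalk y, c ≠ 0 →
          (∀ e : ℕ, c * a ^ p ^ e ∈ Ideal.span ((fun z : Y.presheaf.stalk y => z ^ p ^ e) ''
            (I : Set (Y.presheaf.stalk y)))) → a ∈ I) ∧
        IsIso (ρ ∣_ (V.ι ⁻¹ᵁ U)) ∧ Dense ((ρ ⁻¹ᵁ (V.ι ⁻¹ᵁ U) : Y.Opens) : Set Y) := by
    intro s hs
    obtain ⟨V, hsV, hVS, Y, ρ, hρ, hY, hiso, hd⟩ := hloc s ((hmemS s).mp hs)
    exact ⟨V, hsV, fun t ht htV => hVS t ((hmemS t).mp ht) htV, Y, ρ, hρ, hY, hiso, hd⟩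
  obtain ⟨X', π, hπ, hX'wf, hiso, hd⟩ :=
    weaklyFRegularModel_of_local_models p X U hUwf S hcov hloc'
  -- `U` is dense: it contains the generic point (F-rational stalks are normal, and a normal
  -- local ring of dimension `0` is regular)
  have hN : ∀ x : X, IsIntegrallyClosed (X.presheaf.stalk x) :=
    isIntegrallyClosed_stalk_of_fRational_clause p hp k X f hFR
  have hgen : genericPoint X ∈ U := by
    refine mem_regularLocus_of_ringKrullDim_stalk_le_one hN ?_
    have h0 : ringKrullDim (X.presheaf.stalk (genericPoint X)) = 0 :=
      ringKrullDim_eq_zero_of_field X.functionField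
    rw [h0]; exact zero_le_one
  have hUd : Dense (U : Set X) :=
    U.2.dense ⟨genericPoint X, hgen⟩
  exact ⟨X', π, hπ, ⟨U, hUd, hd, hiso⟩, hX'wf⟩

end Summit.ResolutionOfSingularities.ResolutionOfSingularities.Theorems.FRationalResolution

end
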